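import Mathlib.NumberTheory.Real.Irrational
import Mathlib.RingTheory.KrullDimension.Basic
import Mathlib.RingTheory.RegularLocalRing.Defs
import Mathlib.RingTheory.Valuation.ValuationSubring
import Literature.AlgebraicGeometry.Resolution.QuadraticTransforms
import Literature.AlgebraicGeometry.Resolution.RegularLocalOrderValuation
import HarnessLib

/-!
# Heinzer–Olberding–Toeniskoetter: two transform-trivial non-units with an irrational order ratio force
# the Shannon extension of a sequence of local quadratic transforms to be dominated by a rank-one
# valuation ring (arXiv:1509.07545, Thm. 5.9 (3)(4) + Prop. 5.12 + Thm. 6.1 (4)⇒(6), with Setting 3.3,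
# Def. 5.1 / Remark 2.3, Thm. 5.6; the case `dim S = 1` by [HLOST])

Topic: `Literature/AlgebraicGeometry/Resolution`. NAMED FACT (hypothesis pattern, D-0014 «NEED A PUBLISHED
FACT»), sibling of `HeinzerEtAl2015ShannonValuationRankTwo` (`ShannonValuationRankTwo.lean`) and
`HeinzerEtAl2015HullParameterExists` (`ShannonHullParameter.lean`). Filed for the cell `res-idea`
(run/shared/lean/pub/res-idea), LINE #5 «hp1-frobenius-defect», piece (L) of the K7♯ chain: the consumer is
the kernel-checked composition `K7Sharp_of_HOT` (lens-4 g3, `HOME/lines/hp1-frobenius-defect/line_v33_K7HOT.lean`)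
over `Theorems/Rescue/ResIdeaHP1FrobK7G.lean` (`K7Sharp_of_rankOne_dominating`, p589559), which consumes exactly
the conclusion shape below. Binders drafted by the line author (lens-4 g3, `L_ShannonRankOneCriterion_draft.lean`
62ccd4be01608337) and re-read against the held text by the typer (res-idea-typ-1 g3, 2026-08-28): two corrections
to the draft are recorded in «Print placement» (the exceptional parameter is NONZERO; transform-triviality is
required FROM EVERY STARTING INDEX, see the example there).

## What the source prints (arXiv:1509.07545, W. Heinzer, B. Olberding, M. Toeniskoetter, «Asymptotic properties
## of infinite directed unions of local quadratic transforms», J. Algebra 479 (2017); chunks read 2026-08-28 from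
## the held copy `paper:arxiv-1509.07545` — chunk ids p00NN, not necessarily PDF page numbers)

* **Remark 2.3** (chunk p0005), VERBATIM: «Let `{(R_i, 𝔪_i)}_{i=0}^∞` be a sequence of local quadratic transforms
  of `d`-dimensional regular local rings with `d ≥ 2`. For each `i`, let `x_i` be an element of `𝔪_i` such that
  `𝔪_i R_{i+1} = x_i R_{i+1}`. Let `I` be an ideal in `R_0`. (1) `I R_1 = 𝔪_0^{ord_{R_0}(I)} I^{R_1} =
  x_0^{ord_{R_0}(I)} I^{R_1}` and `I^{R_1} = x_0^{-ord_{R_0}(I)} I R_1`. (2) For `n ≥ 0`,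
  `I R_n = (∏_{i=0}^{n-1} x_i^{ord_{R_i}(I^{R_i})}) I^{R_n}`. (3) The sequence of nonnegative integers
  `ord_{R_i}(I^{R_i})` is nonincreasing.» (`I^{R_n}` = the transform, Definition 2.1; `(I^B)^C = I^C`, Remark 2.2 (1).)
* **Setting 3.3** (chunk p0006), VERBATIM: «We make the following assumptions throughout the paper. • `R` is a
  regular local ring with maximal ideal `𝔪` and quotient field `F`. • `{R_n}_{n ≥ 0}` is an infinite sequence of
  regular local rings, where `R = R_0` and `R_{n+1}` is a local quadratic transform of `R_n` for each `n ≥ 0`.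
  • `dim R = dim R_n = d ≥ 2` for all `n ≥ 0`. Since Krull dimension does not increase upon taking local quadratic
  transform, we achieve this condition by replacing `R` with `R_n` for some large `n`. • `S = ⋃_{n=0}^∞ R_n` denotes
  the Shannon extension of `R` along `{R_n}` and `N = ⋃_{n=0}^∞ 𝔪_n` denotes the maximal ideal of `S`. • For each
  `n ≥ 0`, denote by `ord_n : F → ℤ ∪ {∞}` the order valuation of `R_n` […]. • Fix `x ∈ S` such that `xS` is
  `N`-primary and denote by `T = S[1/x]` the Noetherian hull of `S`; see Theorem (hull)(2). • `T` is a localization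
  of `R`. By Theorem (hull)(2), we achieve this by replacing `R` with `R_n` for some large `n`. […]» (Theorem 3.2
  (2)–(3), from [HLOST]: «There exists `x ∈ N` such that `xS` is `N`-primary, and `T = S[1/x]` for any such `x`»,
  «`T` is a localization of `R_i` for `i ≫ 0`».) Same chunk: «A Shannon extension `S` with `dim S = 1` is a rank 1
  valuation ring, cf. [HLOST].»; chunk p0007: «A Shannon extension `S` is a rank 1 valuation domain if and only if
  `dim S = 1`, cf. [HLOST].»
* **Definition 5.1** (chunk p0008), VERBATIM: «Assume Setting 3.3 and let `a ∈ S` be nonzero. Then `a ∈ R_n` for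
  some `n ≥ 0`. Define `e(a) = lim_{i → ∞} ord_{n+i}((a R_n)^{R_{n+i}})`.»; **Lemma 5.2** (1) «For nonzero `a ∈ F`,
  `e(a)` is well defined», (3) «`e(ab) = e(a) + e(b)`», (4) «For nonzero `a ∈ S`, `e(a) = 0` if and only if
  `a ∈ T^×`.»
* **Theorem 5.6** (chunk p0009), VERBATIM: «Assume notation as in Setting 3.3. For `a ∈ F^×` the (possibly infinite)
  limit `lim_{n → ∞} ord_n(a)/ord_n(x)` exists.»; **Notation 5.7**: «define `w : F → ℝ ∪ {−∞, +∞}` by […]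
  `w(q) = lim_{n→∞} ord_n(q)/ord_n(x)`.»
* **Theorem 5.9** (chunk p0009), VERBATIM: «Assume notation as in Setting 3.3. […] (3) If `a ∈ S`, then `w(a) > 0`
  if and only if `a ∈ N (= 𝔪_V ∩ S)`. (4) Let `a ∈ F^×` be such that `e(a) = 0`. Then `w(a)` is finite, and `a ∈ V`
  if and only if `w(a) ≥ 0`.»
* **Notation 5.11** (chunk p0010): «`τ = Σ_{n=0}^∞ w(x_n)` where `𝔪_n R_{n+1} = x_n R_{n+1}` for `n ≥ 0`.»;
  **Proposition 5.12**, VERBATIM: «Assume Setting 3.3. Let `y_1, …, y_r ∈ 𝔪`, where `r ≥ 2`. If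
  `w(y_1), …, w(y_r)` are finite and rationally independent, then `τ ≤ (w(y_1) + … + w(y_r))/(r − 1)`.»
* **Theorem 6.1** (chunk p0011), VERBATIM: «Assume Setting 3.3 and let `w` and `τ` be as in Notation 5.7 and
  Notation 5.11, respectively. If `dim S ≥ 2`, then the following are equivalent. (1) `S` is archimedean. (2) `w(q)`
  is finite for all nonzero `q ∈ F`. (3) `w(q)` is finite for some nonzero `q ∈ S ∖ T^×`. (4) `τ < ∞`. (5) `w`
  defines a valuation on `F` that dominates `S`. (6) `S` is dominated by a rank 1 valuation domain.»; proof of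
  (5) ⇒ (6): «Since the valuation in (5) has values in `ℝ`, it has rank 1».

## Print placement of the form below (why it is WEAKER than print, never stronger)

Data inside one field `K` (the `F` of print): `R : ℕ → Subring K`, every `R n` a REGULAR local ring of `K`
(`IsLocalRingOf`: quotient field `K`) of Krull dimension `d ≥ 2` (the same `d` for all `n`), each `R (n+1)` a
local quadratic transform of `R n` (`IsQuadraticTransform`, Cutkosky §2.1 — the tree's notion, which includes the
domination `𝔪_{n+1} ∩ R_n = 𝔪_n`); `x : ℕ → K` with `x n ∈ 𝔪_n`, `x n ≠ 0`, `𝔪_n R_{n+1} = x_n R_{n+1}`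
(`IsExceptionalParameter`, the `x_i` of Remark 2.3; nonzero is automatic in print since `𝔪_n ≠ 0`). For `y ∈ R_m`,
`y ≠ 0`, the chain `a_m = y`, `a_{j+1} = a_j / x_j^{ord_j(a_j)}` has `a_j R_j = (y R_m)^{R_j}` (Remark 2.3 (1)(2)
with Remark 2.2 (1)), so `lim_j ord_j(a_j) = lim_i ord_{m+i}((yR_m)^{R_{m+i}})`, and this limit of a
nonincreasing sequence of naturals is `0` iff some `a_j` is a UNIT of `R_j` (`TransformEventuallyUnitFrom R x m y`).
HYPOTHESES on `y₁, y₂`: nonzero, in `𝔪_0` (hence in every `𝔪_n` and in `N`, by domination along the chain),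
`TransformEventuallyUnitFrom R x m y_i` FOR EVERY `m`, and `ord_n(y₁)/ord_n(y₂) → ρ` with `ρ` IRRATIONAL.
CONCLUSION: some valuation subring `W` of `K` of Krull dimension `≤ 1` dominates every `R n`.

Reduction to the printed statements. Replace `R` by `R_{n₀}`, `n₀` large, so that Setting 3.3 holds for the
tail `(R_{n₀+k})_k` (print: «we achieve this by replacing `R` with `R_n` for some large `n`», twice); `S`, `N`
are unchanged and `y_i ∈ 𝔪_{n₀}`. By Definition 5.1 with starting point `R_{n₀}` and the hypothesis at `m = n₀`,
`e(y_i) = 0`; by Theorem 5.9 (4) `w(y_i)` is finite, by (3) `w(y_i) > 0` (`y_i ∈ N`). Hence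
`ord_n(y₁)/ord_n(y₂) = (ord_n(y₁)/ord_n(x)) / (ord_n(y₂)/ord_n(x)) → w(y₁)/w(y₂)` (Theorem 5.6), so
`w(y₁) = ρ·w(y₂)` with `ρ` irrational and `w(y₂) ≠ 0`: `w(y₁), w(y₂)` are rationally independent. Proposition
5.12 (`r = 2`, `y_i ∈ 𝔪 = 𝔪_{n₀}`) gives `τ ≤ w(y₁) + w(y₂) < ∞`; if `dim S ≥ 2`, Theorem 6.1 (4) ⇒ (6) gives a
rank-1 valuation domain `W` of `F` dominating `S` (the proof's `W` is the valuation ring of `w` on `F`); if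
`dim S = 1`, `S` itself is a rank-1 valuation ring ([HLOST], quoted above) and `W = S`. A valuation ring of `K` of
rank 1 has Krull dimension 1; `W` dominates `S`, `S ⊇ R_n` and `𝔪_W ∩ R_n = N ∩ R_n = 𝔪_n`, so `W` dominates
every `R_n` (also `n < n₀`, by transitivity along the quadratic transforms). WEAKER than print: the conclusion
only records `dim W ≤ 1` and domination (not `W = ` the valuation ring of `w`, not `τ ≤ w(y₁)+w(y₂)`, not the
equivalences of Theorem 6.1); the hypotheses ADD the exceptional parameters and the transform chains as data.

Why «from every starting index» (typer's correction of the draft, which started the chain at `R_0` only):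
`e(·)` is start-independent only under Setting 3.3's normalisation «`T` is a localization of `R`» (equivalently
`𝔪_n T = T` for all `n`, chunk p0006). Example: `d = 2`, `R_0 = k[u,v]_{(u,v)}`, `R_1 = R_0[v/u]_{(u,v/u)}`
(`x_0 = u`), `R_2 = R_1[u/(v/u)]` (`x_1 = v/u`) and from then on along the same height-one branch (`x_n = v/u`):
the chain of `u` from `R_0` is a unit at step 1, but `u` lies in the height-one prime of the rank-2 valuation
ring `S`, so `u ∉ T^×` and print's `e(u) = 1` (Lemma 5.2 (4)); the chain of `u R_2` from `R_2` never becomes a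
unit. Requiring the chain condition from every start `m` (in particular from `m ≥ n₀`) is what Definition 5.1
needs. NOT in print and NOT claimed: anything for chains computed from `R_0` only, for `dim R_n` non-constant,
or a converse.

-- TODO(general form): Theorem 6.1 in full ((1)–(6) equivalent for `dim S ≥ 2`), Proposition 5.12 for `r ≥ 2`
-- elements with the bound `τ ≤ Σ w(y_i)/(r−1)`, and the functions `e`, `w`, `τ` themselves (Definition 5.1,
-- Notation 5.7/5.11) as tree objects on a Shannon extension — needs `S`, `N`, the Noetherian hull `T` and the
-- boundary valuation ring `V` as tree objects (cf. the TODO of `ShannonValuationRankTwo.lean`).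

References: W. Heinzer, B. Olberding, M. Toeniskoetter, *Asymptotic properties of infinite directed unions of
local quadratic transforms*, J. Algebra 479 (2017) (= arXiv:1509.07545), Remark 2.3, Setting 3.3, Thm. 3.2,
Def. 5.1, Lemma 5.2, Thm. 5.6, Not. 5.7, Thm. 5.9, Not. 5.11, Prop. 5.12, Thm. 6.1 [HeinzerOlberdingToeniskoetter2017Asymptotic] (doi
10.1016/j.jalgebra.2017.01.009, pp. 216–243; librarian note: the tree's older key `HeinzerOlberdingToeniskoetter2017`, used by
`Summits/…/FrobeniusClosingSteer*.lean` for this same paper, carries this title but the `doi`/`eprint` of the companion paper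
Heinzer–Kim–Toeniskoetter arXiv:1512.03848 — to be reconciled); W. Heinzer, K. A. Loper, B. Olberding, H. Schoutens, M. Toeniskoetter,
J. Algebra 474 (2017) 213–239 (= arXiv:1505.06445) for `dim S = 1 ⇔ S` rank-1 valuation ring [HeinzerEtAl2015];
S. D. Cutkosky (2014) §2.1 (local rings of `K`, domination, quadratic transforms — the tree's
`QuadraticTransforms.lean`) [Cutkosky2014].
-/

noncomputable section

namespace Literature.AlgebraicGeometry.Resolution

open IsLocalRing Filter

universe u

variable {K : Type u} [Field K]

/-- **Exceptional parameter of a local quadratic transform** (the `x_i` of Remark 2.3: «let `x_i` be an element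
of `𝔪_i` such that `𝔪_i R_{i+1} = x_i R_{i+1}`»), inside the common field `K`: `x ∈ R_n` lies in `𝔪_n`, is
NONZERO, and every element of `𝔪_n` is `x` times an element of `R_{n+1}` (so `𝔪_n R_{n+1} ⊆ x R_{n+1}`; the
reverse inclusion is automatic from `x ∈ 𝔪_n`). [cite: HeinzerOlberdingToeniskoetter2017Asymptotic, Remark 2.3] -/
def IsExceptionalParameter (Rn Rn1 : Subring K) [IsLocalRing Rn] (x : K) : Prop :=
  x ≠ 0 ∧ (∃ hx : x ∈ Rn, (⟨x, hx⟩ : Rn) ∈ maximalIdeal Rn) ∧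
    ∀ (z : K) (hz : z ∈ Rn), (⟨z, hz⟩ : Rn) ∈ maximalIdeal Rn → z / x ∈ Rn1

/-- **The transform chain of `y R_m` becomes the unit ideal** — print's `e(y) = 0` computed from the starting
ring `R_m` (Definition 5.1 with Remark 2.3 (1)(2): the transform of the principal ideal `a_j R_j` in `R_{j+1}`
is `a_{j+1} R_{j+1}` with `a_{j+1} · x_j^{ord_j(a_j)} = a_j`, and `e(y) = lim_j ord_j(a_j)` is `0` iff some
`a_j` is a unit): there is a chain `a : ℕ → K` with `a m = y`, `a j ∈ R_j` and
`a (j+1) · (x j)^{ord_{R_j}(a j)} = a j` for `j ≥ m`, and `a n` a UNIT of `R_n` for some `n ≥ m`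
(`ord` = the `𝔪`-adic order `adicOrder`, in `ℕ∞`, read through `toNat`; all `a j` are nonzero when `y ≠ 0`).
[cite: HeinzerOlberdingToeniskoetter2017Asymptotic, Definition 5.1, Remark 2.3] -/
def TransformEventuallyUnitFrom (R : ℕ → Subring K) [∀ n, IsLocalRing (R n)] (x : ℕ → K) (m : ℕ) (y : K) :
    Prop :=
  ∃ a : ℕ → K, a m = y ∧ ∃ ha : ∀ j, m ≤ j → a j ∈ R j,
    (∀ (j : ℕ) (hj : m ≤ j),
        a (j + 1) * x j ^ (adicOrder (⟨a j, ha j hj⟩ : R j)).toNat = a j) ∧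
      ∃ (n : ℕ) (hn : m ≤ n), IsUnit (⟨a n, ha n hn⟩ : R n)

/-- NAMED FACT — **Heinzer–Olberding–Toeniskoetter 2017 (arXiv:1509.07545), Theorem 5.9 (3)(4) + Proposition 5.12
+ Theorem 6.1 (4) ⇒ (6), read through Setting 3.3 / Definition 5.1 / Theorem 5.6, with the case `dim S = 1` from
[HLOST]: for an infinite sequence `R_0 → R_1 → ⋯` of `d`-dimensional (`d ≥ 2`) regular local rings of a field
`K`, each the local quadratic transform of the previous one, with exceptional parameters `x_n`
(`𝔪_n R_{n+1} = x_n R_{n+1}`), if two nonzero elements `y₁, y₂` of `𝔪_0` have transform chains that become the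
unit ideal from EVERY starting ring `R_m` (print's `e(y_i) = 0`) and `ord_{R_n}(y₁)/ord_{R_n}(y₂)` converges to
an IRRATIONAL real number, then some valuation ring of `K` of Krull dimension `≤ 1` dominates every `R_n`**
(print: `e(y_i) = 0 ⇒ w(y_i)` finite (5.9 (4)); `y_i ∈ N ⇒ w(y_i) > 0` (5.9 (3)); then
`w(y₁)/w(y₂) = lim ord_n(y₁)/ord_n(y₂)` is irrational, so `w(y₁), w(y₂)` are rationally independent;
Proposition 5.12 (`r = 2`) gives `τ < ∞`; Theorem 6.1 (4) ⇒ (6) gives a rank-1 valuation domain dominating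
`S = ⋃ R_n`, hence every `R_n`; if `dim S = 1`, `S` itself is one). The reduction, the tail normalisation of
Setting 3.3 and the example showing why the chain condition is required from every start are in the module
docstring («Print placement»). WEAKER than print (conclusion `dim W ≤ 1` + domination only). Users take
`(h : HeinzerOlberdingToeniskoetter2017ShannonRankOneCriterion)`.
[cite: HeinzerOlberdingToeniskoetter2017Asymptotic, Thm. 5.9 (3)(4), Prop. 5.12, Thm. 6.1 (4)⇒(6), Setting 3.3, Def. 5.1, Thm. 5.6]
[cite: HeinzerEtAl2015, §3 (dim S = 1 ⇔ rank-1 valuation ring)] [cite: Cutkosky2014, §2.1] -/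
def HeinzerOlberdingToeniskoetter2017ShannonRankOneCriterion : Prop :=
  ∀ (K : Type u) [Field K] (R : ℕ → Subring K) [∀ n, IsLocalRing (R n)] (d : ℕ), 2 ≤ d →
    (∀ n, IsLocalRingOf (R n)) →
    (∀ n, IsRegularLocalRing (R n)) →
    (∀ n, ringKrullDim (R n) = d) →
    (∀ n, IsQuadraticTransform (R n) (R (n + 1))) →
    ∀ (x : ℕ → K), (∀ n, IsExceptionalParameter (R n) (R (n + 1)) (x n)) →
    ∀ (y₁ y₂ : K) (h₁ : ∀ n, y₁ ∈ R n) (h₂ : ∀ n, y₂ ∈ R n),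
      y₁ ≠ 0 → y₂ ≠ 0 →
      (⟨y₁, h₁ 0⟩ : R 0) ∈ maximalIdeal (R 0) → (⟨y₂, h₂ 0⟩ : R 0) ∈ maximalIdeal (R 0) →
      (∀ m, TransformEventuallyUnitFrom R x m y₁) → (∀ m, TransformEventuallyUnitFrom R x m y₂) →
      (∃ ρ : ℝ, Irrational ρ ∧
        Tendsto (fun n : ℕ =>
            ((adicOrder (⟨y₁, h₁ n⟩ : R n)).toNat : ℝ) / ((adicOrder (⟨y₂, h₂ n⟩ : R n)).toNat : ℝ))
          atTop (nhds ρ)) →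
      ∃ W : ValuationSubring K, ringKrullDim W ≤ 1 ∧ ∀ n, SubringDominates (R n) W.toSubring

end Literature.AlgebraicGeometry.Resolution

end
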